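import Mathlib
import Literature.NumberTheory.NumberFields.PureCubicRationalGenus
import Literature.NumberTheory.NumberFields.PureCubicDegreeOnePrimes
import HarnessLib

/-!
# Pure cubic fields: the rational genus homomorphism is surjective; `3^t ∣ h` without class field theory

Topic `NumberTheory/NumberFields`.  Theorem-only file (no definition, no named fact, D-0026),
unconditional; continuation of `PureCubicRationalGenus.lean`.  For a cubic `K ∋ ∛m` and a finite
set `S` of primes `ℓ ≡ 1 (mod 3)` with `3 ∤ v_ℓ(m)`, the rational genus homomorphism
`G : Cl(K) → ∏_{ℓ ∈ S} (ℤ/ℓ)ˣ/(ℤ/ℓ)ˣ³`, `G([𝔞])_ℓ = N𝔞 mod (ℤ/ℓ)ˣ³`, is SURJECTIVE: for prescribed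
unit residues `a_ℓ` choose, by Dirichlet's theorem and the Chinese remainder theorem, a prime
`p ≡ 2 (mod 3)`, `p ≡ a_ℓ (mod ℓ)`, `p ∤ 3m`; since cubing is a bijection of `𝔽_p`, `m` is a cube
mod `p` and `𝔭 = (p, θ − r)` is a prime ideal of norm `p` (Dedekind–Kummer, tree
`PureCubic.absNorm_span_pair`), so `G([𝔭]) = (a_ℓ)_ℓ`.  As `(ℤ/ℓ)ˣ/(ℤ/ℓ)ˣ³` has order `3` for
`ℓ ≡ 1 (mod 3)`, this yields **`3^{#S} ∣ h(K)` by rational genus theory alone** — no class field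
theory, no Artin map (Barrucand–Cohn's "rational genus"; cf. the class-field-theoretic genus bound
`Honda1971.pow_card_dvd_classNumber` of `PureCubicGenusRank.lean`).

* `Honda1971.card_units_quot_cubes` — `#((ℤ/ℓ)ˣ/(ℤ/ℓ)ˣ³) = 3` for `ℓ ≡ 1 (mod 3)`;
* `Honda1971.exists_pow_three_eq_of_mod_three` — cubing is onto `ℤ/p` for `p ≡ 2 (mod 3)`;
* `Honda1971.exists_prime_modEq_two_and_forall` — a prime `p ≡ 2 (3)`, `p ≡ a_ℓ (ℓ)`, `p > n`;
* `Honda1971.exists_rationalGenusHom_surjective` — **the rational genus homomorphism is onto**;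
* `Honda1971.pow_card_dvd_classNumber_of_rationalGenus` — `3^{#S} ∣ h(K)`, elementary proof.

## References

* P. Barrucand, H. Cohn, *A rational genus, class number divisibility, and unit theory for pure
  cubic fields*, J. Number Theory 2 (1970) 7–21. [BarrucandCohn1970]
* M. Ishida, *The genus fields of algebraic number fields*, LNM 555 (1976), Ch. 4, Ch. 7 (7.7). [Ishida1976]
* H. Cohen, *A Course in Computational Algebraic Number Theory* (1993), §4.8.2, §6.4
  (Dedekind–Kummer for `ℚ(∛m)`). [Cohen1993]
-/

noncomputable section

open Polynomial NumberField IsDedekindDomain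
open scoped IntermediateField nonZeroDivisors

namespace Literature.NumberTheory.NumberFields

namespace Honda1971

variable {K : Type*} [Field K] [NumberField K]

/-! ### Arithmetic of `ℤ/ℓ` and `ℤ/p` -/

/-- For a prime `ℓ ≡ 1 (mod 3)` the cubes have index `3` in `(ℤ/ℓ)ˣ`:
`#((ℤ/ℓ)ˣ/(ℤ/ℓ)ˣ³) = 3`. [folklore] -/
theorem card_units_quot_cubes {ℓ : ℕ} (hℓ : ℓ.Prime) (hℓ1 : ℓ % 3 = 1) :
    Nat.card ((ZMod ℓ)ˣ ⧸ (powMonoidHom 3 : (ZMod ℓ)ˣ →* (ZMod ℓ)ˣ).range) = 3 := by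
  haveI : Fact ℓ.Prime := ⟨hℓ⟩
  change (powMonoidHom 3 : (ZMod ℓ)ˣ →* (ZMod ℓ)ˣ).range.index = 3
  rw [IsCyclic.index_powMonoidHom_range, Nat.card_eq_fintype_card, ZMod.card_units_eq_totient,
    Nat.totient_prime hℓ]
  have h3 : 3 ∣ ℓ - 1 := by have := hℓ.two_le; omega
  exact Nat.gcd_eq_right h3

/-- For a prime `p ≡ 2 (mod 3)` every residue is a cube: `x ↦ x³` is a bijection of `ℤ/p`
(`3 ∤ p − 1 = #(ℤ/p)ˣ`). [folklore] -/
theorem exists_pow_three_eq_of_mod_three {p : ℕ} (hp : p.Prime) (hp2 : p % 3 = 2)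
    (x : ZMod p) : ∃ r : ZMod p, r ^ 3 = x := by
  classical
  haveI : Fact p.Prime := ⟨hp⟩
  by_cases hx : x = 0
  · exact ⟨0, by rw [hx, zero_pow three_ne_zero]⟩
  -- cubing is injective on the units, hence surjective
  have hinj : Function.Injective (powMonoidHom 3 : (ZMod p)ˣ →* (ZMod p)ˣ) := by
    rw [← MonoidHom.ker_eq_bot_iff, Subgroup.eq_bot_iff_forall]
    intro v hv
    rw [MonoidHom.mem_ker, powMonoidHom_apply] at hv
    have h1 : orderOf v ∣ 3 := orderOf_dvd_of_pow_eq_one hv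
    have h2 : orderOf v ∣ p - 1 := by
      rw [← Nat.totient_prime hp, ← ZMod.card_units_eq_totient]
      exact orderOf_dvd_card
    have h3 : ¬ 3 ∣ p - 1 := by have := hp.two_le; omega
    rcases (Nat.dvd_prime Nat.prime_three).mp h1 with h | h
    · exact orderOf_eq_one_iff.mp h
    · exact absurd (h ▸ h2) h3
  have hsurj : Function.Surjective (powMonoidHom 3 : (ZMod p)ˣ →* (ZMod p)ˣ) :=
    Finite.surjective_of_injective hinj
  obtain ⟨v, hv⟩ := hsurj (Units.mk0 x hx)
  refine ⟨(v : ZMod p), ?_⟩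
  rw [← Units.val_pow_eq_pow_val, ← powMonoidHom_apply, hv, Units.val_mk0]

/-- **A prime in prescribed classes** (Dirichlet + CRT): for a finite set `S` of primes
`ℓ ≡ 1 (mod 3)` and units `a_ℓ ∈ (ℤ/ℓ)ˣ` there is a prime `p > n` with `p ≡ 2 (mod 3)` and
`p ≡ a_ℓ (mod ℓ)` for all `ℓ ∈ S`. [folklore] -/
theorem exists_prime_modEq_two_and_forall (S : Finset ℕ) (hS : ∀ ℓ ∈ S, ℓ.Prime ∧ ℓ % 3 = 1)
    (a : ∀ ℓ : S, (ZMod (ℓ : ℕ))ˣ) (n : ℕ) :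
    ∃ p : ℕ, n < p ∧ p.Prime ∧ p % 3 = 2 ∧ ∀ ℓ : S, ((p : ℕ) : ZMod (ℓ : ℕ)) = a ℓ := by
  classical
  -- CRT on the moduli `insert 3 S`
  set T : Finset ℕ := insert 3 S with hT
  have h3S : (3 : ℕ) ∉ S := fun h => by have := (hS 3 h).2; omega
  have hTprime : ∀ q ∈ T, q.Prime := by
    intro q hq
    rcases Finset.mem_insert.mp hq with rfl | hq
    · exact Nat.prime_three
    · exact (hS q hq).1
  let res : ℕ → ℕ := fun q => if h : q ∈ S then ((a ⟨q, h⟩ : ZMod q)).val else 2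
  have hs : ∀ q ∈ T, (id q : ℕ) ≠ 0 := fun q hq => (hTprime q hq).ne_zero
  have hpp : Set.Pairwise (T : Set ℕ) (Function.onFun Nat.Coprime id) := by
    intro q hq q' hq' hne
    exact (Nat.coprime_primes (hTprime q hq) (hTprime q' hq')).mpr hne
  obtain ⟨k, hk⟩ := Nat.chineseRemainderOfFinset res id T hs hpp
  -- `k` is prime to `M = ∏ T`
  set M : ℕ := ∏ q ∈ T, q with hM
  have hM0 : M ≠ 0 := Finset.prod_ne_zero_iff.mpr fun q hq => (hTprime q hq).ne_zero
  have hkcop : Nat.Coprime k M := by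
    refine Nat.Coprime.prod_right fun q hq => ?_
    have hqp := hTprime q hq
    rw [Nat.coprime_comm, Nat.Prime.coprime_iff_not_dvd hqp]
    intro hdvd
    have hkq : k ≡ res q [MOD q] := hk q hq
    have h0 : res q ≡ 0 [MOD q] :=
      (hkq.symm.trans (Nat.modEq_zero_iff_dvd.mpr hdvd))
    rw [Nat.modEq_zero_iff_dvd] at h0
    by_cases hqS : q ∈ S
    · haveI : Fact q.Prime := ⟨hqp⟩
      have hval : res q = ((a ⟨q, hqS⟩ : ZMod q)).val := dif_pos hqS
      rw [hval] at h0
      have : ((a ⟨q, hqS⟩ : ZMod q)) = 0 := by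
        rw [← ZMod.natCast_zmod_val (a ⟨q, hqS⟩ : ZMod q), ZMod.natCast_eq_zero_iff]
        exact h0
      exact (a ⟨q, hqS⟩).ne_zero this
    · have hq3 : q = 3 := by
        rcases Finset.mem_insert.mp hq with h | h
        · exact h
        · exact absurd h hqS
      have hval : res q = 2 := dif_neg hqS
      rw [hval, hq3] at h0
      omega
  -- Dirichlet
  obtain ⟨p, hpn, hp, hpk⟩ := Nat.forall_exists_prime_gt_and_zmodEq (max n M) hM0
    (Nat.isCoprime_iff_coprime.mpr hkcop)
  have hpmod : ∀ q ∈ T, p ≡ res q [MOD q] := by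
    intro q hq
    have hqM : (q : ℤ) ∣ (M : ℤ) := by exact_mod_cast Finset.dvd_prod_of_mem _ hq
    have h1 : (p : ℤ) ≡ (k : ℤ) [ZMOD (q : ℕ)] := Int.ModEq.of_dvd hqM hpk
    exact (Int.natCast_modEq_iff.mp h1).trans (hk q hq)
  have hnp : n < p := lt_of_le_of_lt (le_max_left _ _) hpn
  refine ⟨p, hnp, hp, ?_, fun ℓ => ?_⟩
  · have h := hpmod 3 (Finset.mem_insert_self 3 S)
    have hval : res 3 = 2 := dif_neg h3S
    rw [hval] at h
    exact h
  · haveI : NeZero (ℓ : ℕ) := ⟨(hS ℓ ℓ.2).1.ne_zero⟩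
    have hℓT : (ℓ : ℕ) ∈ T := Finset.mem_insert_of_mem ℓ.2
    have h := hpmod ℓ hℓT
    have hval : res ℓ = ((a ℓ : (ZMod (ℓ : ℕ))ˣ) : ZMod (ℓ : ℕ)).val := dif_pos ℓ.2
    rw [hval] at h
    rw [(ZMod.natCast_eq_natCast_iff' _ _ _).mpr h, ZMod.natCast_zmod_val]

/-! ### Surjectivity of the rational genus homomorphism -/

/-- **The rational genus homomorphism is surjective (Barrucand–Cohn).**  For a cubic number field
`K ∋ ∛m` and a finite set `S` of primes `ℓ ≡ 1 (mod 3)` with `3 ∤ v_ℓ(m)`, there is a SURJECTIVE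
homomorphism `G : Cl(K) ↠ ∏_{ℓ ∈ S} (ℤ/ℓ)ˣ/(ℤ/ℓ)ˣ³` with `G([𝔞])_ℓ = N𝔞 mod (ℤ/ℓ)ˣ³` for every
nonzero ideal `𝔞` prime to `ℓ`.  Surjectivity: a prime `p ≡ 2 (mod 3)` in prescribed classes mod
the `ℓ ∈ S` (Dirichlet) has a prime ideal factor `𝔭 = (p, θ − r)` of norm `p` in `K`
(Dedekind–Kummer; `m` is a cube mod `p`). [cite: BarrucandCohn1970] [cite: Ishida1976, Ch. 4]
[cite: Cohen1993, §6.4] -/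
theorem exists_rationalGenusHom_surjective {m : ℕ} (S : Finset ℕ)
    (hS : ∀ ℓ ∈ S, ℓ.Prime ∧ ℓ % 3 = 1 ∧ ¬ 3 ∣ padicValNat ℓ m)
    (K : Type*) [Field K] [NumberField K] (h3 : Module.finrank ℚ K = 3) {α : K}
    (hα : α ^ 3 = (m : K)) :
    ∃ G : ClassGroup (𝓞 K) →*
        (Π ℓ : S, (ZMod (ℓ : ℕ))ˣ ⧸ (powMonoidHom 3 : (ZMod (ℓ : ℕ))ˣ →* (ZMod (ℓ : ℕ))ˣ).range),
      Function.Surjective G ∧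
      ∀ (I : (Ideal (𝓞 K))⁰) (ℓ : S) (u : (ZMod (ℓ : ℕ))ˣ),
        (u : ZMod (ℓ : ℕ)) = Ideal.absNorm (I : Ideal (𝓞 K)) →
          G (ClassGroup.mk0 I) ℓ = QuotientGroup.mk u := by
  classical
  obtain ⟨G, hG⟩ := exists_rationalGenusHom S (fun ℓ h => ⟨(hS ℓ h).1, (hS ℓ h).2.2⟩) K h3 hα
  refine ⟨G, fun t => ?_, hG⟩
  rcases S.eq_empty_or_nonempty with rfl | hSne
  · exact ⟨1, funext fun ℓ => absurd ℓ.2 (Finset.notMem_empty _)⟩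
  obtain ⟨ℓ₀, hℓ₀S⟩ := hSne
  obtain ⟨hℓ₀, -, hm₀⟩ := hS ℓ₀ hℓ₀S
  haveI : ∀ ℓ : S, Fact (ℓ : ℕ).Prime := fun ℓ => ⟨(hS ℓ ℓ.2).1⟩
  -- `m` is not a cube; an algebraic integer `θ` with `θ³ = m`
  have hcube : ∀ r : ℕ, r ^ 3 ≠ m := by
    intro r hr
    exact pow_three_ne_of_not_dvd_padicValNat hℓ₀ hm₀ (r : ℚ) (by exact_mod_cast hr)
  obtain ⟨θ, -, hθ⟩ := PureCubic.exists_ringOfIntegers_of_cube_eq hα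
  -- lift the target to units and choose the prime `p`
  choose a ha using fun ℓ : S => QuotientGroup.mk_surjective (t ℓ)
  obtain ⟨p, hpn, hp, hp2, hpa⟩ :=
    exists_prime_modEq_two_and_forall S (fun ℓ h => ⟨(hS ℓ h).1, (hS ℓ h).2.1⟩) a (3 * m)
  have hpm : ¬ p ∣ 3 * m := by
    intro h
    have hm0 : 3 * m ≠ 0 := by
      intro h0
      have : m = 0 := by omega
      exact hcube 0 (by rw [this]; norm_num)
    exact absurd (Nat.le_of_dvd (Nat.pos_of_ne_zero hm0) h) (not_le.mpr hpn)
  -- a cube root `r` of `m` mod `p` and the prime `𝔭 = (p, θ - r)` of norm `p`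
  haveI : Fact p.Prime := ⟨hp⟩
  obtain ⟨r, hr⟩ := exists_pow_three_eq_of_mod_three hp hp2 (m : ZMod p)
  have hr' : (((r.val : ℕ) : ℤ) : ZMod p) ^ 3 = (m : ZMod p) := by
    rw [Int.cast_natCast, ZMod.natCast_zmod_val, hr]
  set P : Ideal (𝓞 K) := Ideal.span {(p : 𝓞 K), θ - ((r.val : ℕ) : ℤ)} with hPdef
  have hPnorm : Ideal.absNorm P = p := PureCubic.absNorm_span_pair h3 hcube hθ hp hpm hr'
  have hP0 : P ≠ ⊥ := by
    intro h
    rw [h, Ideal.absNorm_bot] at hPnorm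
    exact hp.ne_zero hPnorm.symm
  refine ⟨ClassGroup.mk0 ⟨P, mem_nonZeroDivisors_iff_ne_zero.mpr hP0⟩, funext fun ℓ => ?_⟩
  -- the unit `p mod ℓ = a ℓ`
  have hval : ((a ℓ : (ZMod (ℓ : ℕ))ˣ) : ZMod (ℓ : ℕ)) = Ideal.absNorm P := by
    rw [hPnorm, hpa ℓ]
  rw [hG ⟨P, _⟩ ℓ (a ℓ) hval, ha ℓ]

/-- **`3^{#S} ∣ h(K)` by rational genus theory** (no class field theory): the rational genus
homomorphism maps `Cl(K)` onto a group of order `3^{#S}`. [cite: BarrucandCohn1970]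
[cite: Ishida1976, Ch. 7 eq. (7.7)] -/
theorem pow_card_dvd_classNumber_of_rationalGenus {m : ℕ} (S : Finset ℕ)
    (hS : ∀ ℓ ∈ S, ℓ.Prime ∧ ℓ % 3 = 1 ∧ ¬ 3 ∣ padicValNat ℓ m)
    (K : Type*) [Field K] [NumberField K] (h3 : Module.finrank ℚ K = 3) {α : K}
    (hα : α ^ 3 = (m : K)) :
    3 ^ S.card ∣ classNumber K := by
  classical
  obtain ⟨G, hG, -⟩ := exists_rationalGenusHom_surjective S hS K h3 hα
  -- (the `Group` instance on the product of quotients is supplied explicitly)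
  have h := @Subgroup.card_dvd_of_surjective (ClassGroup (𝓞 K))
    (Π ℓ : S, (ZMod (ℓ : ℕ))ˣ ⧸ (powMonoidHom 3 : (ZMod (ℓ : ℕ))ˣ →* (ZMod (ℓ : ℕ))ˣ).range)
    _ Pi.group G hG
  have hcard : Nat.card (Π ℓ : S, (ZMod (ℓ : ℕ))ˣ ⧸
      (powMonoidHom 3 : (ZMod (ℓ : ℕ))ˣ →* (ZMod (ℓ : ℕ))ˣ).range) = 3 ^ S.card := by
    rw [Nat.card_pi, Finset.prod_congr rfl fun (ℓ : S) _ =>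
      card_units_quot_cubes (hS ℓ.1 ℓ.2).1 (hS ℓ.1 ℓ.2).2.1, Finset.prod_const, Finset.card_univ,
      Fintype.card_coe]
  rw [hcard] at h
  rwa [classNumber, ← Nat.card_eq_fintype_card]

end Honda1971

end Literature.NumberTheory.NumberFields

end
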